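import Mathlib
import HarnessLib

/-!
# V. A. Markov's inequality for the coefficients of a bounded polynomial

T. J. Rivlin, *The Chebyshev Polynomials* (Wiley, 1974) [Rivlin1974], Sect. 2.7 «Size of Coefficients», Remark 2,
(2.44)–(2.45) (V. A. Markov 1892).  Write `T_n(x) = Σ_k t_k^{(n)} x^k`, `p = a_0 + a_1 x + ⋯`, `I = [-1, 1]`,
`η_j^{(n)} = cos(jπ/n)` (`j = 0, …, n`, the extrema of `T_n`; Mathlib's `Polynomial.Chebyshev.node`).
(2.44): if `deg p ≤ n`, `|p(η_j^{(n)})| ≤ 1` for all `j` and `n - j` is even, then `|a_j| ≤ |t_j^{(n)}|`;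
(2.45): if `n - j` is odd (and `p` is so bounded at the extrema of `T_{n-1}`), then `|a_j| ≤ |t_j^{(n-1)}|`.
Hence for `deg p ≤ n`, `|p| ≤ M` on `I`: `|a_j| ≤ M |t_j^{(n')}|`, `n' ∈ {n, n-1}` of the parity of `j`.  The case
`j = n` is Chebyshev's leading-coefficient theorem, Mathlib's `Polynomial.Chebyshev.coeff_le_of_forall_abs_le_one`.

PROOF (interpolation proof, extending Mathlib's `Chebyshev/Extremal.lean`; Rivlin uses the canonical representations
of Sect. 2.6 instead).  `a_j(p) = Σ_i p(η_i) c_i`, `c_i = [x^j] ℓ_i` (Lagrange, `coeff_eq_sum_node`).  SIGN LEMMA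
(`sign_coeff_basis`): for `n - j = 2t`, `(-1)^{i+t} c_i ≥ 0` for every `i`, since `ℓ_i = w_i Π_{m ≠ i}(x - η_m)` with
`(-1)^i w_i > 0` (Mathlib `zero_lt_prod_node_sub_node`) and, the nodes being symmetric (`η_{n-m} = -η_m`),
`Π_{m ≠ i}(x - η_m) = (x + η_i) · x^ε · Π (x² - η_m²)` has `x^{n-2t}`-coefficient of sign `(-1)^t` (peel the pairs
`{η_a, η_{n-a}}` off the window `a ≤ m ≤ n - a`: `alt_prod_window`, `top_prod_window_erase`).  So
`Σ_i |c_i| = |Σ_i (-1)^i c_i| = |t_j^{(n)}|` (`T_n(η_i) = (-1)^i`; Mathlib's `sumNodes_le_sumNodes_T` packages the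
comparison), which is (2.44).  (2.45) = (2.44) for `n - 1` applied to the parity-`j` part `(p(x) ± p(-x))/2`.

What is here (all PROVED, no definitions): `coeff_eq_sum_node`; `coeff_nodal_erase_sign`, `sign_coeff_basis`;
`abs_coeff_le_abs_coeff_T` ((2.44), bound `1` on `I`); `abs_coeff_le_of_abs_eval_le` (bound `M`);
`abs_coeff_le_of_abs_eval_le_succ` ((2.44) ∧ (2.45): `deg p ≤ n + 1`, `|p| ≤ M` on `I`, `j + 2t = n` ⟹
`|a_j| ≤ M |t_j^{(n)}|`); `abs_coeff_le_mul_max_abs_coeff_T` (`|a_j| ≤ M · max(|t_j^{(d)}|, |t_j^{(d-1)}|)` for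
`deg p ≤ d`, every `j`).  NOT here: equality cases (`p = ± T_n`), (2.38)/(2.42)–(2.43) (partial coefficient sums),
V. A. Markov's derivative theorem (Sect. 2.7.5); the hypothesis is boundedness on all of `I` (as in Mathlib), not
Rivlin's node-wise `p ∈ C_n`.
-/

noncomputable section

namespace Literature.Analysis.Approximation.MarkovCoefficientInequality

open Polynomial Polynomial.Chebyshev Real Finset

/-! ### The extrema `η_j = cos(jπ/n)` form a symmetric node set -/

/-- `η_{n-m} = -η_m` (`cos(π - θ) = -cos θ`). [cite: Rivlin1974, Sect. 1.2] -/
theorem node_sub {n m : ℕ} (hn : n ≠ 0) (hm : m ≤ n) : node n (n - m) = -node n m := by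
  rw [node, node, Nat.cast_sub hm]
  have hn' : (n : ℝ) ≠ 0 := Nat.cast_ne_zero.2 hn
  rw [show ((n : ℝ) - m) * π / n = π - m * π / n by field_simp]
  exact Real.cos_pi_sub _

/-- The middle extremum of `T_{2m}` is `η_m = cos(π/2) = 0`. [cite: Rivlin1974, Sect. 1.2] -/
theorem node_half {n m : ℕ} (hn : n ≠ 0) (h : 2 * m = n) : node n m = 0 := by
  have hm : (m : ℝ) ≠ 0 := by exact_mod_cast (show m ≠ 0 by omega)
  rw [node, ← h, Nat.cast_mul, Nat.cast_two, show (m : ℝ) * π / (2 * m) = π / 2 by field_simp]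
  exact Real.cos_pi_div_two

/-! ### Alternating coefficients (bookkeeping; `Q` *alternating of order `d`*: `[x^s] Q` has sign `(-1)^t`
when `s + 2t = d` and vanishes otherwise; *top-alternating*: the sign condition plus vanishing above `d`) -/

/-- `[x^s]((x² - c) Q) = [x^{s-2}] Q - c [x^s] Q`. [folklore] -/
private theorem coeff_X_sq_sub_C_mul (Q : ℝ[X]) (c : ℝ) (s : ℕ) :
    ((X ^ 2 - C c) * Q).coeff s = (if 2 ≤ s then Q.coeff (s - 2) else 0) - c * Q.coeff s := by
  rw [sub_mul, coeff_sub, coeff_X_pow_mul', coeff_C_mul]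

/-- The constant polynomial `1` is alternating of order `0`. [folklore] -/
private theorem alt_one : ∀ s : ℕ, (∀ t, s + 2 * t = 0 → 0 ≤ (-1 : ℝ) ^ t * (1 : ℝ[X]).coeff s) ∧
    ((∀ t, s + 2 * t ≠ 0) → (1 : ℝ[X]).coeff s = 0) := by
  intro s
  refine ⟨fun t ht => ?_, fun h => ?_⟩
  · obtain ⟨rfl, rfl⟩ : s = 0 ∧ t = 0 := ⟨by omega, by omega⟩; simp
  · by_cases hs : s = 0
    · exact absurd (by omega : s + 2 * 0 = 0) (h 0)
    · rw [coeff_one, if_neg hs]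

/-- The polynomial `x` is alternating of order `1`. [folklore] -/
private theorem alt_X : ∀ s : ℕ, (∀ t, s + 2 * t = 1 → 0 ≤ (-1 : ℝ) ^ t * (X : ℝ[X]).coeff s) ∧
    ((∀ t, s + 2 * t ≠ 1) → (X : ℝ[X]).coeff s = 0) := by
  intro s
  refine ⟨fun t ht => ?_, fun h => ?_⟩
  · obtain ⟨rfl, rfl⟩ : s = 1 ∧ t = 0 := ⟨by omega, by omega⟩; simp
  · by_cases hs : s = 1
    · exact absurd (by omega : s + 2 * 0 = 1) (h 0)
    · exact coeff_X_of_ne_one hs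

/-- Multiplication by `x² - c`, `c ≥ 0`, raises the order of an alternating polynomial by `2`. [folklore] -/
private theorem alt_mul_sq {Q : ℝ[X]} {d : ℕ}
    (hQ : ∀ s, (∀ t, s + 2 * t = d → 0 ≤ (-1 : ℝ) ^ t * Q.coeff s) ∧
      ((∀ t, s + 2 * t ≠ d) → Q.coeff s = 0))
    {c : ℝ} (hc : 0 ≤ c) :
    ∀ s, (∀ t, s + 2 * t = d + 2 → 0 ≤ (-1 : ℝ) ^ t * ((X ^ 2 - C c) * Q).coeff s) ∧
      ((∀ t, s + 2 * t ≠ d + 2) → ((X ^ 2 - C c) * Q).coeff s = 0) := by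
  intro s
  rw [coeff_X_sq_sub_C_mul]
  refine ⟨fun t ht => ?_, fun h => ?_⟩
  · have hB : 0 ≤ -((-1 : ℝ) ^ t * (c * Q.coeff s)) := by
      rcases t with _ | t
      · rw [(hQ s).2 fun t' h' => by omega]; simp
      · rw [pow_succ]; nlinarith [mul_nonneg hc ((hQ s).1 t (by omega))]
    split_ifs with hs
    · have hA := (hQ (s - 2)).1 t (by omega)
      rw [mul_sub]; linarith
    · rw [zero_sub, mul_neg]; linarith
  · have h1 : Q.coeff s = 0 := (hQ s).2 fun t ht => h (t + 1) (by omega)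
    split_ifs with hs
    · rw [h1, (hQ (s - 2)).2 fun t ht => h t (by omega)]; ring
    · rw [h1]; ring

/-- Multiplication by `x + η` (any real `η`) turns an alternating polynomial of order `d` into a top-alternating
one of order `d + 1`: the other parity class of `Q` vanishes, so `η` never meets a live coefficient.
[folklore] -/
private theorem top_lin_mul {Q : ℝ[X]} {d : ℕ}
    (hQ : ∀ s, (∀ t, s + 2 * t = d → 0 ≤ (-1 : ℝ) ^ t * Q.coeff s) ∧
      ((∀ t, s + 2 * t ≠ d) → Q.coeff s = 0))
    (η : ℝ) :
    ∀ s, (∀ t, s + 2 * t = d + 1 → 0 ≤ (-1 : ℝ) ^ t * ((X + C η) * Q).coeff s) ∧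
      (d + 1 < s → ((X + C η) * Q).coeff s = 0) := by
  intro s
  rcases s with _ | s
  · rw [add_mul, coeff_add, coeff_X_mul_zero, coeff_C_mul, zero_add]
    refine ⟨fun t ht => ?_, fun h => absurd h (by omega)⟩
    rw [(hQ 0).2 fun t' h' => by omega]; simp
  · rw [add_mul, coeff_add, coeff_X_mul, coeff_C_mul]
    refine ⟨fun t ht => ?_, fun h => ?_⟩
    · have hA := (hQ s).1 t (by omega)
      have hB : Q.coeff (s + 1) = 0 := (hQ (s + 1)).2 fun t' h' => by omega
      rwa [hB, mul_zero, add_zero]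
    · have hA : Q.coeff s = 0 := (hQ s).2 fun t' h' => by omega
      have hB : Q.coeff (s + 1) = 0 := (hQ (s + 1)).2 fun t' h' => by omega
      rw [hA, hB]; ring

/-- The constant polynomial `1` is top-alternating of order `0`. [folklore] -/
private theorem top_one : ∀ s : ℕ, (∀ t, s + 2 * t = 0 → 0 ≤ (-1 : ℝ) ^ t * (1 : ℝ[X]).coeff s) ∧
    (0 < s → (1 : ℝ[X]).coeff s = 0) := by
  intro s
  refine ⟨fun t ht => (alt_one s).1 t ht, fun h => ?_⟩
  rw [coeff_one, if_neg (by omega)]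

/-- Multiplication by `x² - c`, `c ≥ 0`, raises the order of a top-alternating polynomial by `2`. [folklore] -/
private theorem top_mul_sq {Q : ℝ[X]} {d : ℕ}
    (hQ : ∀ s, (∀ t, s + 2 * t = d → 0 ≤ (-1 : ℝ) ^ t * Q.coeff s) ∧ (d < s → Q.coeff s = 0))
    {c : ℝ} (hc : 0 ≤ c) :
    ∀ s, (∀ t, s + 2 * t = d + 2 → 0 ≤ (-1 : ℝ) ^ t * ((X ^ 2 - C c) * Q).coeff s) ∧
      (d + 2 < s → ((X ^ 2 - C c) * Q).coeff s = 0) := by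
  intro s
  rw [coeff_X_sq_sub_C_mul]
  refine ⟨fun t ht => ?_, fun h => ?_⟩
  · have hB : 0 ≤ -((-1 : ℝ) ^ t * (c * Q.coeff s)) := by
      rcases t with _ | t
      · rw [(hQ s).2 (by omega)]; simp
      · rw [pow_succ]; nlinarith [mul_nonneg hc ((hQ s).1 t (by omega))]
    split_ifs with hs
    · have hA := (hQ (s - 2)).1 t (by omega)
      rw [mul_sub]; linarith
    · rw [zero_sub, mul_neg]; linarith
  · have h1 : Q.coeff s = 0 := (hQ s).2 (by omega)
    split_ifs with hs
    · rw [h1, (hQ (s - 2)).2 (by omega)]; ring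
    · rw [h1]; ring

/-! ### Peeling symmetric pairs off the window `a ≤ m ≤ n - a` -/

/-- The window products `Π_{m=a}^{n-a} (x - η_m)` are alternating of order `n + 1 - 2a`
(`(x - η_a)(x - η_{n-a}) = x² - η_a²`; the innermost window is empty or `{η_{n/2}} = {0}`).
[cite: Rivlin1974, Sect. 1.2 and Ex. 1.3.4] -/
theorem alt_prod_window {n : ℕ} (hn0 : n ≠ 0) : ∀ w a : ℕ, n + 1 ≤ 2 * a + w →
    ∀ s, (∀ t, s + 2 * t = n + 1 - 2 * a →
        0 ≤ (-1 : ℝ) ^ t * (∏ m ∈ Icc a (n - a), (X - C (node n m))).coeff s) ∧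
      ((∀ t, s + 2 * t ≠ n + 1 - 2 * a) → (∏ m ∈ Icc a (n - a), (X - C (node n m))).coeff s = 0) := by
  intro w
  induction w with
  | zero =>
    intro a ha
    have he : Icc a (n - a) = ∅ := Finset.Icc_eq_empty (by omega)
    rw [he, prod_empty, show n + 1 - 2 * a = 0 by omega]
    exact alt_one
  | succ w ih =>
    intro a ha
    by_cases h : n + 1 ≤ 2 * a + w
    · exact ih a h
    have hn : n = 2 * a + w := by omega
    rcases Nat.eq_zero_or_pos w with rfl | hw
    · have he : Icc a (n - a) = {a} := by rw [show n - a = a by omega, Icc_self]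
      rw [he, prod_singleton, node_half hn0 (by omega : 2 * a = n), map_zero, sub_zero,
        show n + 1 - 2 * a = 1 by omega]
      exact alt_X
    · have he : Icc a (n - a) = insert a (insert (n - a) (Icc (a + 1) (n - (a + 1)))) := by
        ext m; simp only [mem_Icc, mem_insert]; omega
      have h1 : a ∉ insert (n - a) (Icc (a + 1) (n - (a + 1))) := by simp only [mem_insert, mem_Icc]; omega
      have h2 : (n - a) ∉ Icc (a + 1) (n - (a + 1)) := by simp only [mem_Icc]; omega
      rw [he, prod_insert h1, prod_insert h2, ← mul_assoc, node_sub (by omega) (by omega : a ≤ n),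
        show (X - C (node n a)) * (X - C (-node n a)) = X ^ 2 - C (node n a ^ 2) by
          rw [map_neg, map_pow]; ring,
        show n + 1 - 2 * a = (n + 1 - 2 * (a + 1)) + 2 by omega]
      exact alt_mul_sq (ih (a + 1) (by omega)) (sq_nonneg _)

/-- With one node `η_i` removed (`a ≤ i ≤ n - a`), the window product `Π_{a ≤ m ≤ n-a, m ≠ i} (x - η_m)` is
top-alternating of order `n - 2a`: it is `(x + η_i)` times an alternating product. [cite: Rivlin1974, Ex. 1.3.4] -/
theorem top_prod_window_erase (n i : ℕ) : ∀ w a : ℕ, n ≤ 2 * a + w → a ≤ i → i ≤ n - a →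
    ∀ s, (∀ t, s + 2 * t = n - 2 * a →
        0 ≤ (-1 : ℝ) ^ t * (∏ m ∈ (Icc a (n - a)).erase i, (X - C (node n m))).coeff s) ∧
      (n - 2 * a < s → (∏ m ∈ (Icc a (n - a)).erase i, (X - C (node n m))).coeff s = 0) := by
  intro w
  induction w with
  | zero =>
    intro a ha hai hia
    have h1 : i = a := by omega
    rw [h1, show n - a = a by omega, Icc_self, erase_singleton, prod_empty, show n - 2 * a = 0 by omega]
    exact top_one
  | succ w ih =>
    intro a ha hai hia
    by_cases h : n ≤ 2 * a + w
    · exact ih a h hai hia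
    have hn : n = 2 * a + w + 1 := by omega
    have he : Icc a (n - a) = insert a (insert (n - a) (Icc (a + 1) (n - (a + 1)))) := by
        ext m; simp only [mem_Icc, mem_insert]; omega
    have h1 : a ∉ insert (n - a) (Icc (a + 1) (n - (a + 1))) := by simp only [mem_insert, mem_Icc]; omega
    have h2 : (n - a) ∉ Icc (a + 1) (n - (a + 1)) := by simp only [mem_Icc]; omega
    have h3 : a ∉ Icc (a + 1) (n - (a + 1)) := by simp only [mem_Icc]; omega
    rcases eq_or_lt_of_le hai with hia0 | hai'
    · -- the removed node is the left end of the window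
      rw [he, ← hia0, erase_insert h1, prod_insert h2, sub_eq_add_neg, ← map_neg,
        show n - 2 * a = (n + 1 - 2 * (a + 1)) + 1 by omega]
      exact top_lin_mul (alt_prod_window (by omega) w (a + 1) (by omega)) _
    rcases eq_or_lt_of_le hia with hia1 | hia'
    · -- the removed node is the right end of the window
      rw [he, hia1, erase_insert_of_ne (by omega), erase_insert h2, prod_insert h3, sub_eq_add_neg,
        ← map_neg, show n - 2 * a = (n + 1 - 2 * (a + 1)) + 1 by omega]
      exact top_lin_mul (alt_prod_window (by omega) w (a + 1) (by omega)) _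
    · -- the removed node is inside: peel the pair `{η_a, η_{n-a}}`
      have h1' : a ∉ insert (n - a) ((Icc (a + 1) (n - (a + 1))).erase i) := by simp only [mem_insert, mem_Icc, mem_erase]; omega
      have h2' : (n - a) ∉ (Icc (a + 1) (n - (a + 1))).erase i := by simp only [mem_Icc, mem_erase]; omega
      rw [he, erase_insert_of_ne (by omega), erase_insert_of_ne (by omega), prod_insert h1',
        prod_insert h2', ← mul_assoc, node_sub (by omega) (by omega : a ≤ n),
        show (X - C (node n a)) * (X - C (-node n a)) = X ^ 2 - C (node n a ^ 2) by
          rw [map_neg, map_pow]; ring,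
        show n - 2 * a = (n - 2 * (a + 1)) + 2 by omega]
      exact top_mul_sq (ih (a + 1) (by omega) (by omega) (by omega)) (sq_nonneg _)

/-- **Core of the sign lemma.** For `i ≤ n` and `s + 2t = n`, the `x^s`-coefficient of `Π_{m ≠ i} (x - η_m)`
(product over the other extrema of `T_n`) has the sign `(-1)^t`, independently of `i`.
[cite: Rivlin1974, Sect. 2.7 Remark 2 (2.44)] -/
theorem coeff_nodal_erase_sign {n i : ℕ} (hi : i ≤ n) {s t : ℕ} (hst : s + 2 * t = n) :
    0 ≤ (-1 : ℝ) ^ t * (Lagrange.nodal ((range (n + 1)).erase i) (node n)).coeff s := by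
  have hr : range (n + 1) = Icc 0 (n - 0) := by
        ext m; simp only [mem_range, mem_Icc]; omega
  rw [Lagrange.nodal_eq, hr]
  exact (top_prod_window_erase n i n 0 (by omega) (Nat.zero_le _) (by omega) s).1 t (by omega)

/-- **Sign lemma.** For `i ≤ n` and `s + 2t = n`: `(-1)^{i+t} [x^s] ℓ_i ≥ 0`, where `ℓ_i` is the fundamental
(Lagrange) polynomial of the node `η_i` among the `n + 1` extrema of `T_n`.
[cite: Rivlin1974, Sect. 2.7 Remark 2 (2.44)] -/
theorem sign_coeff_basis {n i : ℕ} (hi : i ≤ n) {s t : ℕ} (hst : s + 2 * t = n) :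
    0 ≤ (-1 : ℝ) ^ i * ((-1) ^ t * (Lagrange.basis (range (n + 1)) (node n) i).coeff s) := by
  have him : i ∈ range (n + 1) := mem_range.2 (Nat.lt_succ_of_le hi)
  rw [Lagrange.basis_eq_prod_sub_inv_mul_nodal_div him, ← Lagrange.nodal_erase_eq_nodal_div him,
    coeff_C_mul]
  have hw : 0 < (-1 : ℝ) ^ i * Lagrange.nodalWeight (range (n + 1)) (node n) i := by
    have := inv_pos_of_pos (zero_lt_prod_node_sub_node hi)
    rw [mul_inv, ← inv_pow, inv_neg_one, ← prod_inv_distrib] at this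
    rw [Lagrange.nodalWeight]
    exact this
  have hN := coeff_nodal_erase_sign hi hst
  calc (0 : ℝ) ≤ ((-1) ^ i * Lagrange.nodalWeight (range (n + 1)) (node n) i) *
        ((-1) ^ t * (Lagrange.nodal ((range (n + 1)).erase i) (node n)).coeff s) := mul_nonneg hw.le hN
    _ = _ := by ring

/-! ### Coefficients from values at the extrema -/

/-- Lagrange interpolation at the extrema read coefficient-wise: for `deg p ≤ n`,
`a_s(p) = Σ_{i=0}^{n} p(η_i) · [x^s] ℓ_i`. [cite: Rivlin1974, Sect. 1.3 (1.27)] -/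
theorem coeff_eq_sum_node {n : ℕ} {P : ℝ[X]} (hP : P.degree ≤ n) (s : ℕ) :
    P.coeff s = ∑ i ∈ range (n + 1),
      P.eval (node n i) * (Lagrange.basis (range (n + 1)) (node n) i).coeff s := by
  have hlt : P.degree < #(range (n + 1)) := by
    rw [card_range]
    exact lt_of_le_of_lt hP (by exact_mod_cast Nat.lt_succ_self n)
  conv_lhs => rw [Lagrange.eq_interpolate (strictAntiOn_node n).injOn hlt]
  rw [Lagrange.interpolate_apply, finsetSum_coeff]
  exact sum_congr rfl fun i _ => by rw [coeff_C_mul]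

/-- Private copy of the folklore parity rule `[x^k] p(-x) = (-1)^k [x^k] p(x)` (also in
`Literature.Analysis.ODE.LadderKernel`, not imported here). [folklore] -/
private theorem coeff_comp_negX (p : ℝ[X]) (k : ℕ) :
    (p.comp (-X)).coeff k = (-1) ^ k * p.coeff k := by
  induction p using Polynomial.induction_on' with
  | add p q hp hq => simp only [add_comp, coeff_add, hp, hq, mul_add]
  | monomial m a =>
      rw [← C_mul_X_pow_eq_monomial, mul_comp, C_comp, X_pow_comp, neg_pow,
        show (-1 : ℝ[X]) ^ m = Polynomial.C ((-1 : ℝ) ^ m) by simp, ← mul_assoc, ← map_mul,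
        coeff_C_mul_X_pow, coeff_C_mul_X_pow]
      split_ifs with h
      · subst h; ring
      · simp

/-! ### V. A. Markov's coefficient inequality -/

/-- **(2.44), bound `1`.** If `deg p ≤ n`, `|p| ≤ 1` on `[-1, 1]` and `s + 2t = n`, then `|a_s(p)| ≤ |t_s^{(n)}|`.
[cite: Rivlin1974, Sect. 2.7 Remark 2 (2.44)] -/
theorem abs_coeff_le_abs_coeff_T {n : ℕ} {P : ℝ[X]} (hP : P.degree ≤ n)
    (hb : ∀ x ∈ Set.Icc (-1 : ℝ) 1, |P.eval x| ≤ 1) {s t : ℕ} (hst : s + 2 * t = n) :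
    |P.coeff s| ≤ |(T ℝ n).coeff s| := by
  set c : ℕ → ℝ := fun i => (-1) ^ t * (Lagrange.basis (range (n + 1)) (node n) i).coeff s with hc
  have hcs : ∀ i ≤ n, 0 ≤ (-1) ^ i * c i := fun i hi => sign_coeff_basis hi hst
  have key : ∀ Q : ℝ[X], Q.degree ≤ n → sumNodes n c Q = (-1) ^ t * Q.coeff s := by
    intro Q hQ
    rw [sumNodes, coeff_eq_sum_node hQ s, mul_sum, ← Nat.range_succ_eq_Iic]
    exact sum_congr rfl fun i _ => by rw [hc]; ring
  have hT : (T ℝ n).degree ≤ n := by rw [degree_T, Int.natAbs_natCast]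
  have h1 := sumNodes_le_sumNodes_T hcs hb
  have h2 := sumNodes_le_sumNodes_T hcs (P := -P) (by simpa using hb)
  rw [key P hP, key _ hT] at h1
  rw [key (-P) (by rwa [degree_neg]), key _ hT, coeff_neg] at h2
  have habs : |(-1 : ℝ) ^ t * P.coeff s| ≤ (-1) ^ t * (T ℝ n).coeff s := abs_le.2 ⟨by linarith, h1⟩
  calc |P.coeff s| = |(-1 : ℝ) ^ t * P.coeff s| := by rw [abs_mul, abs_neg_one_pow, one_mul]
    _ ≤ (-1) ^ t * (T ℝ n).coeff s := habs
    _ ≤ |(-1 : ℝ) ^ t * (T ℝ n).coeff s| := le_abs_self _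
    _ = |(T ℝ n).coeff s| := by rw [abs_mul, abs_neg_one_pow, one_mul]

/-- **(2.44), bound `M`.** If `deg p ≤ n`, `|p| ≤ M` on `[-1, 1]` and `s + 2t = n`, then
`|a_s(p)| ≤ M |t_s^{(n)}|`. [cite: Rivlin1974, Sect. 2.7 Remark 2 (2.44)] -/
theorem abs_coeff_le_of_abs_eval_le {n : ℕ} {P : ℝ[X]} (hP : P.degree ≤ n) {M : ℝ}
    (hb : ∀ x ∈ Set.Icc (-1 : ℝ) 1, |P.eval x| ≤ M) {s t : ℕ} (hst : s + 2 * t = n) :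
    |P.coeff s| ≤ M * |(T ℝ n).coeff s| := by
  have hM : 0 ≤ M := (abs_nonneg _).trans (hb 0 ⟨by norm_num, by norm_num⟩)
  rcases hM.eq_or_lt with hM0 | hMpos
  · have hP0 : P = 0 := by
      apply Polynomial.eq_zero_of_infinite_isRoot
      refine Set.Infinite.mono ?_ (Set.Icc_infinite (by norm_num : (-1 : ℝ) < 1))
      intro x hx
      exact abs_nonpos_iff.1 (hM0 ▸ hb x hx)
    rw [hP0, ← hM0]; simp
  · have hb' : ∀ x ∈ Set.Icc (-1 : ℝ) 1, |(C M⁻¹ * P).eval x| ≤ 1 := by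
      intro x hx
      rw [eval_mul, eval_C, abs_mul, abs_inv, abs_of_pos hMpos, inv_mul_le_iff₀ hMpos, mul_one]
      exact hb x hx
    have hdeg : (C M⁻¹ * P).degree ≤ n := (degree_C_mul (inv_ne_zero hMpos.ne')).le.trans hP
    have h := abs_coeff_le_abs_coeff_T hdeg hb' hst
    rwa [coeff_C_mul, abs_mul, abs_inv, abs_of_pos hMpos, inv_mul_le_iff₀ hMpos] at h

/-- **V. A. Markov's coefficient inequality, (2.44) and (2.45) together.** If `deg p ≤ n + 1`, `|p| ≤ M` on
`[-1, 1]` and `s + 2t = n` (so `s` has the parity of `n`, and the degree may exceed `n` by one), then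
`|a_s(p)| ≤ M |t_s^{(n)}|`.  Proof: apply (2.44) to the parity-`s` part `(p(x) + (-1)^n p(-x))/2`, which has degree
`≤ n`, the same `s`-th coefficient, and is bounded by `M` on `[-1, 1]`.
[cite: Rivlin1974, Sect. 2.7 Remark 2 (2.44)-(2.45)] -/
theorem abs_coeff_le_of_abs_eval_le_succ {n : ℕ} {P : ℝ[X]} (hP : P.natDegree ≤ n + 1) {M : ℝ}
    (hb : ∀ x ∈ Set.Icc (-1 : ℝ) 1, |P.eval x| ≤ M) {s t : ℕ} (hst : s + 2 * t = n) :
    |P.coeff s| ≤ M * |(T ℝ n).coeff s| := by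
  set Q : ℝ[X] := C (1 / 2 : ℝ) * (P + C ((-1 : ℝ) ^ n) * P.comp (-X)) with hQ
  have hQc : ∀ k, Q.coeff k = 1 / 2 * (P.coeff k + (-1) ^ n * ((-1) ^ k * P.coeff k)) := by
    intro k; rw [hQ, coeff_C_mul, coeff_add, coeff_C_mul, coeff_comp_negX]
  have hQs : Q.coeff s = P.coeff s := by
    rw [hQc, ← mul_assoc, ← pow_add, show n + s = 2 * (s + t) by omega, pow_mul]
    norm_num; ring
  have hQdeg : Q.natDegree ≤ n := by
    rw [natDegree_le_iff_coeff_eq_zero]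
    intro N hN
    rw [hQc]
    rcases eq_or_lt_of_le (Nat.succ_le_of_lt hN) with h | h
    · rw [← h]
      have e : (-1 : ℝ) ^ n * (-1) ^ (n + 1) = -1 := by
        rw [← pow_add, show n + (n + 1) = 2 * n + 1 by ring, pow_succ, pow_mul]; norm_num
      calc (1 : ℝ) / 2 * (P.coeff (n + 1) + (-1) ^ n * ((-1) ^ (n + 1) * P.coeff (n + 1)))
          = 1 / 2 * (P.coeff (n + 1) + ((-1) ^ n * (-1) ^ (n + 1)) * P.coeff (n + 1)) := by ring
        _ = 0 := by rw [e]; ring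
    · rw [coeff_eq_zero_of_natDegree_lt (by omega)]; ring
  have hQb : ∀ x ∈ Set.Icc (-1 : ℝ) 1, |Q.eval x| ≤ M := by
    intro x hx
    have h1 := hb x hx
    have h2 := hb (-x) ⟨by linarith [hx.2], by linarith [hx.1]⟩
    have h3 : |P.eval x + (-1) ^ n * P.eval (-x)| ≤ |P.eval x| + |P.eval (-x)| := by
      calc |P.eval x + (-1) ^ n * P.eval (-x)| ≤ |P.eval x| + |(-1 : ℝ) ^ n * P.eval (-x)| := abs_add_le _ _
        _ = |P.eval x| + |P.eval (-x)| := by rw [abs_mul, abs_neg_one_pow, one_mul]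
    rw [hQ]
    simp only [eval_mul, eval_C, eval_add, eval_comp, eval_neg, eval_X]
    rw [abs_mul, abs_of_pos (by norm_num : (0 : ℝ) < 1 / 2)]
    linarith
  rw [← hQs]
  exact abs_coeff_le_of_abs_eval_le (degree_le_of_natDegree_le hQdeg) hQb hst

/-- **Parity-free reading.** If `deg p ≤ d` and `|p| ≤ M` on `[-1, 1]`, then for every `j`,
`|a_j(p)| ≤ M · max(|t_j^{(d)}|, |t_j^{(d-1)}|)` (the first entry is the live one when `d - j` is even, the second
when it is odd; for `j > d` both sides vanish up to `M ≥ 0`). [cite: Rivlin1974, Sect. 2.7 Remark 2 (2.44)-(2.45)] -/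
theorem abs_coeff_le_mul_max_abs_coeff_T {d : ℕ} {P : ℝ[X]} (hP : P.natDegree ≤ d) {M : ℝ}
    (hb : ∀ x ∈ Set.Icc (-1 : ℝ) 1, |P.eval x| ≤ M) (j : ℕ) :
    |P.coeff j| ≤ M * max |(T ℝ d).coeff j| |(T ℝ (d - 1 : ℕ)).coeff j| := by
  have hM : 0 ≤ M := (abs_nonneg _).trans (hb 0 ⟨by norm_num, by norm_num⟩)
  by_cases hj : j ≤ d
  · obtain ⟨t, ht⟩ | ⟨t, ht⟩ := Nat.even_or_odd (d - j)
    · have h := abs_coeff_le_of_abs_eval_le_succ (n := d) (hP.trans (Nat.le_succ d)) hb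
        (s := j) (t := t) (by omega)
      exact h.trans (mul_le_mul_of_nonneg_left (le_max_left _ _) hM)
    · have h := abs_coeff_le_of_abs_eval_le_succ (n := d - 1) (hP.trans (by omega)) hb
        (s := j) (t := t) (by omega)
      exact h.trans (mul_le_mul_of_nonneg_left (le_max_right _ _) hM)
  · rw [coeff_eq_zero_of_natDegree_lt (by omega), abs_zero]
    exact mul_nonneg hM ((abs_nonneg _).trans (le_max_left _ _))

end Literature.Analysis.Approximation.MarkovCoefficientInequality

end
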